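import Summits.NavierStokesRegularity.NavierStokesRegularity.Theses.AngularGalerkinLadder
import Summits.NavierStokesRegularity.NavierStokesRegularity.Theorems.NoOverheating.Negative.SineFormAlignmentExcluded
import Literature.Analysis.FluidPDE.VorticityDoubleConeSelfSimilar
import HarnessLib

/-!
# Kinematic rigidity of rung profiles: what a witness of `RungIsSingular L` can never be
# (route `AngularGalerkinLadder`; Negative lane of crux K2 `NoOverheating`, read for crux K1)

Refuter seat (ns-blowup-refuter g17), Negative lane (`--supports stmt-NavierStokesRegularity-19960`).
No definition, no named fact, no item verdict moves; nothing is asserted about Navier–Stokes.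

The K2 census (`ExcludedStrataCensusV5.excludedStrata_windowSequences_v5`, strata (S0)–(S13))
excludes WINDOW profiles through the amplitude floor `‖u(−1, x₀)‖ ≥ δ`.  Several of its strata are
purely KINEMATIC — they use only the exact rotated discrete self-similarity `IsRotatedDSS c R u`,
the Type-I decay, `div u = 0` and the smoothness of the slices, never the equation or the defect —
and therefore bear equally on crux K1 `RungBlowupCofinal`, whose witnesses are NONTRIVIAL rung
profiles (`RungIsSingular L := ∃ …, IsRungProfile L C₀ c R u p d ∧ ∃ t < 0, ∃ x, u t x ≠ 0`).
This file collects those readings in one place, adding the window-to-everywhere transport: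

* `rungProfile_eq_zero_of_eq_zero_on_window` — a rung profile vanishing on the window slices
  `s ∈ (−1, 0)` vanishes at every `t < 0` (every negative time is carried into the window by
  finitely many DSS periods, `slice_eq_conj_of_isRotatedDSS`);
* `not_nontrivial_rungProfile_of_locallyBounded` / `_of_steady` — (S11): bounded on one backward
  parabolic cylinder `Q_ρ(0,0)` (in particular steady with a continuous slice) ⇒ trivial
  (tree `IsRotatedDSS.eq_zero_of_norm_le_parabolicCylinder`, Chae–Wolf 2017 §3 step 1);
* `not_nontrivial_rungProfile_of_sineAlignment` / `_of_continuousAlignment` — (S13)/(S9b):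
  vorticity directions aligned on the window above a threshold with a modulus, sign-free or signed
  ⇒ every window slice has line-parallel vorticity (`exists_parallel_curl_of_sineAlignment`) ⇒ the
  window slices vanish (`rungProfile_slice_eq_zero_of_parallelVorticity`) ⇒ trivial;
* `rungIsSingular_witness_census` — one decl: a witness of `RungIsSingular L` is in none of
  (S10) screw/translation-invariant slice norms at all times (KJ-47
  `not_nontrivial_rungProfile_of_screw_invariant`), (S11a) locally bounded at the origin,
  (S11b) steady, (S12) line-parallel slice vorticity at all times (KJ-49
  `not_nontrivial_rungProfile_of_parallelVorticity`), (S13) sign-free aligned directions on the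
  window.

WHAT ESCAPES (for K1 ideators): nothing here touches profiles that are unbounded near `(0, 0)`,
unsteady, with no isometric symmetry of unbounded orbits and with vorticity directions carrying no
modulus on the window — in particular the mean–wave / precessing candidates of the current K1 line
(`Cruxes/RungBlowupCofinal/Lines/qlwave.lean`), whose `n`-fold symmetry has bounded orbits.

References: [cite: ChaeWolf2017, Def. 1.1 and §3]; [cite: KochNadirashviliSereginSverak2009, (1.6)];
[cite: GigaMiura2011, Thm 1.3, Prop. 2.2]; [cite: BeiraodaveigaBerselli2002, Thm 1.1].
-/

noncomputable section

namespace Summit.NavierStokesRegularity.AngularGalerkinLadderRungProfileKinematicRigidity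

open Set Function Filter Topology
open Literature.Analysis Literature.Analysis.FluidPDE
open Summit.NavierStokesRegularity.FluidComputer
open Summit.NavierStokesRegularity.FluidComputer.AngularLadder
open Summit.NavierStokesRegularity.NavierStokesRegularity.Theses.AngularGalerkinLadder
open Summit.NavierStokesRegularity.AngularGalerkinLadderRotatedDSSVorticityDirection
open Summit.NavierStokesRegularity.AngularGalerkinLadderTranslationalSymmetryExcluded
open Summit.NavierStokesRegularity.AngularGalerkinLadderSineFormAlignmentExcluded

variable {L : ℕ} {C₀ c : ℝ}
  {R : EuclideanSpace ℝ (Fin 3) ≃ₗᵢ[ℝ] EuclideanSpace ℝ (Fin 3)}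
  {u : ℝ → EuclideanSpace ℝ (Fin 3) → EuclideanSpace ℝ (Fin 3)}
  {p : ℝ → EuclideanSpace ℝ (Fin 3) → ℝ}
  {d : ℝ → EuclideanSpace ℝ (Fin 3) → EuclideanSpace ℝ (Fin 3)}

/-! ### §1 From the window to all negative times -/

/-- One DSS period down: if the slice `s / c²` vanishes identically, so does the slice `s`.
[cite: ChaeWolf2017, Def. 1.1] -/
theorem slice_eq_zero_of_slice_div_eq_zero (h : IsRotatedDSS c R u) (hc : c ≠ 0) {s : ℝ}
    (hz : ∀ y, u (s / c ^ 2) y = 0) : ∀ x, u s x = 0 := by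
  intro x
  rw [slice_eq_conj_of_isRotatedDSS h hc s]
  simp [hz]

/-- **A rotated-DSS field with `1 < c` that vanishes on the window slices `s ∈ (−1, 0)` vanishes at
every negative time**: `t < 0` is carried into the window by `k` periods as soon as
`−t < (c²)ᵏ`. [cite: ChaeWolf2017, Def. 1.1] -/
theorem eq_zero_of_eq_zero_on_window (h : IsRotatedDSS c R u) (hc : 1 < c)
    (hwin : ∀ s ∈ Ioo (-1 : ℝ) 0, ∀ x, u s x = 0) : ∀ t < 0, ∀ x, u t x = 0 := by
  have hc0 : c ≠ 0 := (zero_lt_one.trans hc).ne'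
  have hc2 : 1 < c ^ 2 := by nlinarith
  have hc2pos : 0 < c ^ 2 := zero_lt_one.trans hc2
  -- `P k`: every slice `s < 0` with `−1 < s / (c²)ᵏ` vanishes
  have key : ∀ k : ℕ, ∀ s : ℝ, s < 0 → -1 < s / (c ^ 2) ^ k → ∀ x, u s x = 0 := by
    intro k
    induction k with
    | zero =>
      intro s hs hwin' x
      rw [pow_zero, div_one] at hwin'
      exact hwin s ⟨hwin', hs⟩ x
    | succ k ih =>
      intro s hs hk x
      refine slice_eq_zero_of_slice_div_eq_zero h hc0 (fun y => ih (s / c ^ 2)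
        (div_neg_of_neg_of_pos hs hc2pos) ?_ y) x
      rwa [div_div, ← pow_succ']
  intro t ht x
  obtain ⟨k, hk⟩ := pow_unbounded_of_one_lt (-t) hc2
  refine key k t ht ?_ x
  rw [lt_div_iff₀ (pow_pos hc2pos k)]
  linarith

/-- **A rung profile vanishing on the window slices vanishes at every negative time.**
[cite: ChaeWolf2017, Def. 1.1] -/
theorem rungProfile_eq_zero_of_eq_zero_on_window (hP : IsRungProfile L C₀ c R u p d)
    (hwin : ∀ s ∈ Ioo (-1 : ℝ) 0, ∀ x, u s x = 0) : ∀ t < 0, ∀ x, u t x = 0 :=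
  eq_zero_of_eq_zero_on_window hP.isRotatedDSS hP.one_lt hwin

/-- Hence a rung profile vanishing on the window never witnesses `RungIsSingular L`.
[cite: ChaeWolf2017, Def. 1.1] -/
theorem not_nontrivial_rungProfile_of_eq_zero_on_window (hP : IsRungProfile L C₀ c R u p d)
    (hwin : ∀ s ∈ Ioo (-1 : ℝ) 0, ∀ x, u s x = 0) : ¬ ∃ t < 0, ∃ x, u t x ≠ 0 := by
  rintro ⟨t, ht, x, hx⟩
  exact hx (rungProfile_eq_zero_of_eq_zero_on_window hP hwin t ht x)

/-! ### §2 (S11) Locally bounded at the space-time origin; steady -/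

/-- **(S11a) for K1's witnesses**: a rung profile bounded on one backward parabolic cylinder
`Q_ρ(0, 0)` is trivial (Chae–Wolf 2017, §3 step 1: discrete self-similarity transports the bound
to `sup |u| ≤ B c⁻ᵏ → 0`). [cite: ChaeWolf2017, §3, Step 1] -/
theorem not_nontrivial_rungProfile_of_locallyBounded (hP : IsRungProfile L C₀ c R u p d)
    {ρ B : ℝ} (hρ : 0 < ρ)
    (hB : ∀ z ∈ parabolicCylinder ρ (0 : ℝ × EuclideanSpace ℝ (Fin 3)), ‖u z.1 z.2‖ ≤ B) :
    ¬ ∃ t < 0, ∃ x, u t x ≠ 0 := by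
  rintro ⟨t, ht, x, hx⟩
  exact hx (hP.isRotatedDSS.eq_zero_of_norm_le_parabolicCylinder hP.one_lt hρ hB t ht x)

/-- **(S11b) for K1's witnesses**: a STEADY rung profile (`u(t) = U` for all `t < 0`, `U`
continuous) is trivial. [cite: ChaeWolf2017, §3, Step 1] -/
theorem not_nontrivial_rungProfile_of_steady (hP : IsRungProfile L C₀ c R u p d)
    {U : EuclideanSpace ℝ (Fin 3) → EuclideanSpace ℝ (Fin 3)} (hU : Continuous U)
    (hsteady : ∀ t < 0, u t = U) : ¬ ∃ t < 0, ∃ x, u t x ≠ 0 := by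
  obtain ⟨B, hB⟩ :=
    (isCompact_closedBall (0 : EuclideanSpace ℝ (Fin 3)) 1).exists_bound_of_continuousOn
      hU.continuousOn
  refine not_nontrivial_rungProfile_of_locallyBounded hP one_pos (B := B) fun z hz => ?_
  rw [mem_parabolicCylinder] at hz
  rw [hsteady z.1 hz.1.2]
  exact hB z.2 (Metric.mem_closedBall.mpr hz.2.le)

/-! ### §3 (S13)/(S9b) Aligned vorticity directions on the window -/

/-- **(S13) for K1's witnesses**: a rung profile whose vorticity directions satisfy the sign-free
(sine-form) alignment `min (‖ξ(x) − ξ(y)‖) (‖ξ(x) + ξ(y)‖) ≤ η(‖x − y‖)` on every window slice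
`s ∈ (−1, 0)` wherever `‖ω‖ > d₀` at both points, for some threshold `d₀` and some modulus
`η → 0` at `0⁺`, is trivial: every window slice has line-parallel vorticity, hence vanishes, and
§1 transports the zero to all negative times.
[cite: BeiraodaveigaBerselli2002, Theorem 1.1 (as quoted in Lemarié-Rieusset 2016, Thm 11.7, PDF p. 369)] -/
theorem not_nontrivial_rungProfile_of_sineAlignment (hP : IsRungProfile L C₀ c R u p d)
    {d₀ : ℝ} {η : ℝ → ℝ} (hη : Tendsto η (𝓝[>] 0) (𝓝 0))
    (hSA : ∀ s ∈ Ioo (-1 : ℝ) 0, ∀ x y, d₀ < ‖curl (u s) x‖ → d₀ < ‖curl (u s) y‖ →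
      min ‖vorticityDirection (curl (u s)) x - vorticityDirection (curl (u s)) y‖
          ‖vorticityDirection (curl (u s)) x + vorticityDirection (curl (u s)) y‖ ≤ η ‖x - y‖) :
    ¬ ∃ t < 0, ∃ x, u t x ≠ 0 := by
  refine not_nontrivial_rungProfile_of_eq_zero_on_window hP fun s hs => ?_
  obtain ⟨e, he⟩ := exists_parallel_curl_of_sineAlignment hP.isRotatedDSS hP.one_lt hη hSA hs
  exact rungProfile_slice_eq_zero_of_parallelVorticity hP hs.2 he

/-- **(S9b) for K1's witnesses**: the signed Giga–Miura continuous alignment (CA) on the window is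
the special case `‖ξ(x) − ξ(y)‖ ≤ η(‖x − y‖)`.
[cite: GigaMiura2011, Theorem 1.3 and Remark 1.4 (§1; HUPS preprint #956 p. 4)] -/
theorem not_nontrivial_rungProfile_of_continuousAlignment (hP : IsRungProfile L C₀ c R u p d)
    {d₀ : ℝ} {η : ℝ → ℝ} (hη : Tendsto η (𝓝[>] 0) (𝓝 0))
    (hCA : ∀ s ∈ Ioo (-1 : ℝ) 0, ∀ x y, d₀ < ‖curl (u s) x‖ → d₀ < ‖curl (u s) y‖ →
      ‖vorticityDirection (curl (u s)) x - vorticityDirection (curl (u s)) y‖ ≤ η ‖x - y‖) :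
    ¬ ∃ t < 0, ∃ x, u t x ≠ 0 :=
  not_nontrivial_rungProfile_of_sineAlignment hP hη fun s hs x y hx hy =>
    (min_le_left _ _).trans (hCA s hs x y hx hy)

/-! ### §4 One decl: the kinematic census of K1's witnesses -/

/-- **Kinematic census for crux K1.** A witness `(u, p, d)` of `RungIsSingular L` — a NONTRIVIAL
rung profile — is in none of the kinematic strata: (S10) all slice norms invariant under one screw
displacement `y ↦ S y + b` (`S b = b`, `b ≠ 0`; translations `S = 1`, helical and axially periodic
symmetry included); (S11a) bounded on a backward parabolic cylinder `Q_ρ(0,0)`; (S11b) steady with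
a continuous slice; (S12) line-parallel vorticity on every slice; (S13) sign-free aligned vorticity
directions on the window `(−1, 0)` above a threshold with a modulus (the signed (CA) being a
special case).  Only `IsRotatedDSS`, Type-I decay, `div u = 0` and slice smoothness are used — no
equation, no defect bound. [cite: ChaeWolf2017, Def. 1.1 and §3, Step 1] -/
theorem rungIsSingular_witness_census (hP : IsRungProfile L C₀ c R u p d)
    (hnt : ∃ t < 0, ∃ x, u t x ≠ 0) :
    ¬ ((∃ (S : EuclideanSpace ℝ (Fin 3) ≃ₗᵢ[ℝ] EuclideanSpace ℝ (Fin 3))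
          (b : EuclideanSpace ℝ (Fin 3)), S b = b ∧ b ≠ 0 ∧ ∀ t < 0, ∀ x, ‖u t (S x + b)‖ = ‖u t x‖) ∨
      (∃ ρ B : ℝ, 0 < ρ ∧
          ∀ z ∈ parabolicCylinder ρ (0 : ℝ × EuclideanSpace ℝ (Fin 3)), ‖u z.1 z.2‖ ≤ B) ∨
      (∃ U : EuclideanSpace ℝ (Fin 3) → EuclideanSpace ℝ (Fin 3), Continuous U ∧ ∀ t < 0, u t = U) ∨
      (∀ t < 0, ∃ e : EuclideanSpace ℝ (Fin 3), ∀ x, ∃ a : ℝ, curl (u t) x = a • e) ∨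
      (∃ (d₀ : ℝ) (η : ℝ → ℝ), Tendsto η (𝓝[>] 0) (𝓝 0) ∧
          ∀ s ∈ Ioo (-1 : ℝ) 0, ∀ x y, d₀ < ‖curl (u s) x‖ → d₀ < ‖curl (u s) y‖ →
            min ‖vorticityDirection (curl (u s)) x - vorticityDirection (curl (u s)) y‖
                ‖vorticityDirection (curl (u s)) x + vorticityDirection (curl (u s)) y‖ ≤
              η ‖x - y‖)) := by
  rintro (⟨S, b, hSb, hb, hinv⟩ | ⟨ρ, B, hρ, hB⟩ | ⟨U, hU, hsteady⟩ | hpar | ⟨d₀, η, hη, hSA⟩)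
  · exact not_nontrivial_rungProfile_of_screw_invariant hP S hSb hb hinv hnt
  · exact not_nontrivial_rungProfile_of_locallyBounded hP hρ hB hnt
  · exact not_nontrivial_rungProfile_of_steady hP hU hsteady hnt
  · exact not_nontrivial_rungProfile_of_parallelVorticity hP hpar hnt
  · exact not_nontrivial_rungProfile_of_sineAlignment hP hη hSA hnt

/-- The same census read on the letter of `RungIsSingular L`: every witness avoids the five
kinematic strata. [cite: ChaeWolf2017, Def. 1.1 and §3, Step 1] -/
theorem rungIsSingular_iff_witness_outside_kinematic_strata :
    RungIsSingular L ↔ ∃ (C₀ c : ℝ) (R : EuclideanSpace ℝ (Fin 3) ≃ₗᵢ[ℝ] EuclideanSpace ℝ (Fin 3))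
      (u : ℝ → EuclideanSpace ℝ (Fin 3) → EuclideanSpace ℝ (Fin 3))
      (p : ℝ → EuclideanSpace ℝ (Fin 3) → ℝ)
      (d : ℝ → EuclideanSpace ℝ (Fin 3) → EuclideanSpace ℝ (Fin 3)),
      IsRungProfile L C₀ c R u p d ∧ (∃ t < 0, ∃ x, u t x ≠ 0) ∧
      ¬ ((∃ (S : EuclideanSpace ℝ (Fin 3) ≃ₗᵢ[ℝ] EuclideanSpace ℝ (Fin 3))
            (b : EuclideanSpace ℝ (Fin 3)), S b = b ∧ b ≠ 0 ∧
              ∀ t < 0, ∀ x, ‖u t (S x + b)‖ = ‖u t x‖) ∨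
        (∃ ρ B : ℝ, 0 < ρ ∧
            ∀ z ∈ parabolicCylinder ρ (0 : ℝ × EuclideanSpace ℝ (Fin 3)), ‖u z.1 z.2‖ ≤ B) ∨
        (∃ U : EuclideanSpace ℝ (Fin 3) → EuclideanSpace ℝ (Fin 3),
            Continuous U ∧ ∀ t < 0, u t = U) ∨
        (∀ t < 0, ∃ e : EuclideanSpace ℝ (Fin 3), ∀ x, ∃ a : ℝ, curl (u t) x = a • e) ∨
        (∃ (d₀ : ℝ) (η : ℝ → ℝ), Tendsto η (𝓝[>] 0) (𝓝 0) ∧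
            ∀ s ∈ Ioo (-1 : ℝ) 0, ∀ x y, d₀ < ‖curl (u s) x‖ → d₀ < ‖curl (u s) y‖ →
              min ‖vorticityDirection (curl (u s)) x - vorticityDirection (curl (u s)) y‖
                  ‖vorticityDirection (curl (u s)) x + vorticityDirection (curl (u s)) y‖ ≤
                η ‖x - y‖)) := by
  constructor
  · rintro ⟨C₀, c, R, u, p, d, hP, hnt⟩
    exact ⟨C₀, c, R, u, p, d, hP, hnt, rungIsSingular_witness_census hP hnt⟩
  · rintro ⟨C₀, c, R, u, p, d, hP, hnt, -⟩
    exact ⟨C₀, c, R, u, p, d, hP, hnt⟩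

end Summit.NavierStokesRegularity.AngularGalerkinLadderRungProfileKinematicRigidity
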